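import Mathlib
import HarnessLib
import Literature.MathematicalPhysics.QuantumLattice.KohnLuttinger
import Literature.MathematicalPhysics.QuantumLattice.KohnLuttingerChannelStates
import Literature.MathematicalPhysics.QuantumLattice.KohnLuttingerPairingFormPolar
import Literature.MathematicalPhysics.QuantumLattice.KohnLuttingerLindhardMeasurable
import Summits.HubbardSuperconductivity.HubbardSuperconductivity.Theorems.WeakCouplingBCSWcbcsKohnLuttingerB1gReduction
import Summits.HubbardSuperconductivity.HubbardSuperconductivity.Theorems.WeakCouplingBCSWcbcsKohnLuttingerB1gKlCertForm
import Summits.HubbardSuperconductivity.HubbardSuperconductivity.Theorems.WeakCouplingBCSKlCertTPrimePHReflection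
import Summits.HubbardSuperconductivity.HubbardSuperconductivity.Theorems.ChiralWindowCwChannelInfContinuousL2
import Summits.HubbardSuperconductivity.HubbardSuperconductivity.Theorems.ChiralWindowCwKLChiralWindowD4Invariant
import Summits.HubbardSuperconductivity.HubbardSuperconductivity.Theorems.ChiralWindowCwThesisChannelInfNonpos
import Summits.HubbardSuperconductivity.HubbardSuperconductivity.Theorems.WeakCouplingBCSWcbcsKohnLuttingerB1gSublatticeDuality
import Summits.HubbardSuperconductivity.HubbardSuperconductivity.Theorems.WeakCouplingBCSKlSublatticeHolds
import Summits.HubbardSuperconductivity.HubbardSuperconductivity.Theorems.WeakCouplingBCSKlSublatticeFlip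
import Summits.HubbardSuperconductivity.HubbardSuperconductivity.Theorems.WeakCouplingBCSKlSublatticeNegBand

/-!
# Support S3 `ChannelInfNNNSign`: the sign of `t'` is immaterial for the channel bottoms of the pure `t'` band
# («(KLSCAN)-SUBLATTICE-DUALITY-DISCHARGE» part 13; cell gate-hubbard-kl, seat p4 g20)

For `μ ∈ (-4, 0)`, every `U` and every channel `χ`:
**`klsl_channelInf_negSign : channelInf (squareDispersion 0 (-1)) μ U χ = channelInf (squareDispersion 0 1) μ U χ`**, hence
hubbard-klscan-idea-3's `KlSublattice.channelInfNNNSign_holds : ChannelInfNNNSign` and the dual `B2g` window for the PHYSICAL sign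
`t' < 0` modulo only the twelve enclosures (`KlSublattice.dualWindowB2g_negSign_of_enclosures`).  Route (parts 10–12): the two bands
have the SAME kernel (`χ₀` is even in `t'`) and flip-related Fermi-curve measures; `T₁` twists `D₄` by the deck shift, so only deck-even
channel functions transport — but every channel state has a deck-even part with the same form (part 11), and both problems have
non-positive bottoms: `ε'` by the duality with `ε` (parts 6–9), `-ε'` by explicit DECK-ODD lattice harmonics in every channel
(§26: `cos k₀ + cos k₁`, `sin k₀ sin k₁ (cos k₀ ∓ cos k₁)`, `cos k₀ - cos k₁`, `sin k₀`), whose pairing form vanishes identically.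

* §26 `klsl_inChannel_A1g_of_invariant`, `klsl_inChannel_mul_invariant`, zero sets on the Fermi curve, `klsl_channelInf_nonpos_of_odd`,
  **`klsl_channelInf_neg_nonpos`**;
* §27 `klsl_channelInf_nnn_nonpos`, the two inequalities, **`klsl_channelInf_negSign`**, the `_holds` corollaries.

Honest framing: exact identities between free-band channel problems; with S3 the card's dual window reads for `t' < 0`, the sign
relevant to the far end `t/t' → 0⁻` of the scan axis — still a relabelling far outside `t'/t ∈ [-0.3, 0]`; nothing asserts a margin
at `t'/t ∈ [-0.3, 0)`, the window, `K₃` or superconductivity; a Kohn–Luttinger `O(U²)` channel statement is not ODLRO.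
-/

noncomputable section

set_option linter.dupNamespace false

namespace Summit.HubbardSuperconductivity.HubbardSuperconductivity.Theorems

open MeasureTheory Real Set Literature.MathematicalPhysics.QuantumLattice
open scoped ENNReal Pointwise

/-! ### §26 Deck-odd channel states of `squareDispersion 0 (-1)`: its channel bottoms are `≤ 0` -/

/-- A `D₄`-invariant function is `A1g`. [cite: RaghuKivelsonScalapino2010, §III (17)] -/
theorem klsl_inChannel_A1g_of_invariant {φ : Momentum → ℝ} (h : ∀ (γ : DihedralGroup 4) (k : Momentum), φ (d4Momentum γ k) = φ k) :
    InChannel .A1g φ := by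
  funext k
  rw [d4Project_A1g]
  simp only [h, Finset.sum_const, Finset.card_univ, DihedralGroup.card, nsmul_eq_mul]
  push_cast
  ring

/-- A channel function times a `D₄`-invariant function stays in the channel. [cite: RaghuKivelsonScalapino2010, §III (17)] -/
theorem klsl_inChannel_mul_invariant {χ : D4Irrep} {φ h : Momentum → ℝ} (hφ : InChannel χ φ)
    (hh : ∀ (γ : DihedralGroup 4) (k : Momentum), h (d4Momentum γ k) = h k) : InChannel χ (fun k => φ k * h k) := by
  funext k
  have hk := congrFun hφ k
  simp only [d4Project] at hk ⊢
  simp only [hh]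
  conv_rhs => rw [← hk]
  rw [Finset.mul_sum, Finset.mul_sum, Finset.sum_mul]
  exact Finset.sum_congr rfl fun γ _ => by ring

/-- `cos k₀ + cos k₁` is `D₄`-invariant. [folklore] -/
theorem klsl_cosSum_invariant (γ : DihedralGroup 4) (k : Momentum) :
    cos (d4Momentum γ k 0) + cos (d4Momentum γ k 1) = cos (k 0) + cos (k 1) := by
  rcases kl_sp_d4_cases γ with rfl | rfl | rfl | rfl | rfl | rfl | rfl | rfl <;>
    simp only [d4Momentum_r_zero, d4Momentum_r_one, d4Momentum_r_two, d4Momentum_r_three, d4Momentum_sr_zero,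
      d4Momentum_sr_one, d4Momentum_sr_two, d4Momentum_sr_three, rotMomentum_apply_zero, rotMomentum_apply_one,
      reflMomentum_apply_zero, reflMomentum_apply_one, cos_neg, neg_neg] <;> ring

/-- `squareDispersion 0 (-1) k = 4 cos k₀ cos k₁`. [folklore] -/
theorem klsl_squareDispersion_neg_eq (k : Momentum) : squareDispersion 0 (-1) k = 4 * cos (k 0) * cos (k 1) := by
  simp only [squareDispersion]; ring

/-- On the Fermi curve of `squareDispersion 0 (-1)` at a negative level, `cos k₀ ≠ cos k₁`. [folklore] -/
theorem klsl_cos_ne_cos_of_mem_fermiCurve_neg {μ : ℝ} (hμ : μ < 0) {k : Momentum}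
    (hk : k ∈ fermiCurve (squareDispersion 0 (-1)) μ) : cos (k 0) - cos (k 1) ≠ 0 := by
  intro h
  have hε : squareDispersion 0 (-1) k = μ := hk.2
  rw [klsl_squareDispersion_neg_eq, show cos (k 1) = cos (k 0) by linarith] at hε
  nlinarith [sq_nonneg (cos (k 0))]

/-- On the Fermi curve of `squareDispersion 0 (-1)`, the zero set of `cos k₀ + cos k₁` is countable (both cosines are `±√(-μ)/2`),
hence null. [folklore] -/
theorem klsl_fermiCurveMeasure_neg_cosSum_null (μ : ℝ) :
    fermiCurveMeasure (squareDispersion 0 (-1)) μ {k : Momentum | cos (k 0) + cos (k 1) = 0} = 0 := by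
  have hL : MeasurableSet {k : Momentum | cos (k 0) + cos (k 1) = 0} :=
    (measurable_cos.comp klsl_measurable_fst).add (measurable_cos.comp klsl_measurable_snd) (measurableSet_singleton 0)
  refine klph_fermiCurveMeasure_null_of_countable_or_gradient (measurable_squareDispersion 0 (-1)) μ hL (Or.inl ?_)
  set d : ℝ := Real.sqrt (-μ / 4) with hd
  set C : Set ℝ := {x | cos x = d} ∪ {x | cos x = -d} with hC
  have hCc : C.Countable := (countable_setOf_cos_eq d).union (countable_setOf_cos_eq (-d))
  have hsub : {k : Momentum | cos (k 0) + cos (k 1) = 0} ∩ fermiCurve (squareDispersion 0 (-1)) μ ⊆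
      (fun p : ℝ × ℝ => (WithLp.toLp 2 ![p.1, p.2] : Momentum)) '' (C ×ˢ C) := by
    rintro k ⟨hz, hkF⟩
    have hz' : cos (k 1) = -cos (k 0) := by have : cos (k 0) + cos (k 1) = 0 := hz; linarith
    have hε : squareDispersion 0 (-1) k = μ := hkF.2
    rw [klsl_squareDispersion_neg_eq, hz'] at hε
    have hμ0 : 0 ≤ -μ / 4 := by nlinarith [sq_nonneg (cos (k 0))]
    have hsq : cos (k 0) ^ 2 = d ^ 2 := by rw [hd, Real.sq_sqrt hμ0]; linarith
    have hd0 : 0 ≤ d := Real.sqrt_nonneg _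
    have h0' : cos (k 0) = d ∨ cos (k 0) = -d := (abs_eq hd0).1 (by rw [← Real.sqrt_sq_eq_abs, hsq, Real.sqrt_sq hd0])
    have h1' : cos (k 1) = d ∨ cos (k 1) = -d := by
      rcases h0' with h | h
      · right; rw [hz', h]
      · left; rw [hz', h, neg_neg]
    refine ⟨(k 0, k 1), ⟨?_, ?_⟩, ?_⟩
    · rcases h0' with h | h
      · exact Or.inl h
      · exact Or.inr h
    · rcases h1' with h | h
      · exact Or.inl h
      · exact Or.inr h
    · ext i; fin_cases i <;> simp
  exact ((hCc.prod hCc).image _).mono hsub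

/-- **A deck-odd channel function has zero pairing form and gives a channel state** (hypothesis form): a bounded measurable in-channel
function `φ` with `φ ∘ D = -φ` a.e. and `φ ≠ 0` a.e. on a non-zero, finite, deck-symmetric Fermi-curve measure normalises to a channel
state with pairing form `0`; hence `channelInf ≤ 0`. [cite: RaghuKivelsonScalapino2010, §II (13)] -/
theorem klsl_channelInf_nonpos_of_odd {ε : Momentum → ℝ} (hε : Measurable ε) {μ : ℝ} (U : ℝ) {χ : D4Irrep}
    [IsFiniteMeasure (fermiCurveMeasure ε μ)]
    (hD : MeasurePreserving klphShift (fermiCurveMeasure ε μ) (fermiCurveMeasure ε μ))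
    (hK : ∀ k, ∀ k' ∈ brillouinZone, kohnLuttingerKernel ε μ U k (klphShift k') = kohnLuttingerKernel ε μ U k k')
    (hbdd : BddBelow ((pairingForm ε μ U) '' {ψ | IsChannelState ε μ χ ψ}))
    (hσ : fermiCurveMeasure ε μ ≠ 0) {φ : Momentum → ℝ} (hφm : Measurable φ) {C : ℝ} (hφC : ∀ k, |φ k| ≤ C)
    (hch : InChannel χ φ) (hodd : ∀ᵐ k ∂fermiCurveMeasure ε μ, φ (klphShift k) = -φ k)
    (hne : ∀ᵐ k ∂fermiCurveMeasure ε μ, φ k ≠ 0) : channelInf ε μ U χ ≤ 0 := by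
  have hmem : MemLp φ 2 (fermiCurveMeasure ε μ) :=
    MemLp.of_bound hφm.aestronglyMeasurable C (Filter.Eventually.of_forall fun k => by rw [Real.norm_eq_abs]; exact hφC k)
  have hint : Integrable (fun k => φ k ^ 2) (fermiCurveMeasure ε μ) := (memLp_two_iff_integrable_sq hmem.1).1 hmem
  have hpos : 0 < ∫ k, φ k ^ 2 ∂fermiCurveMeasure ε μ := by
    have hnn : 0 ≤ ∫ k, φ k ^ 2 ∂fermiCurveMeasure ε μ := integral_nonneg fun k => sq_nonneg (φ k)
    rcases hnn.eq_or_lt with h0 | hlt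
    · exfalso
      have hae := (integral_eq_zero_iff_of_nonneg (fun k => sq_nonneg (φ k)) hint).1 h0.symm
      have hfalse : ∀ᵐ k ∂fermiCurveMeasure ε μ, False := by
        filter_upwards [hae, hne] with k hk hk'
        exact hk' (by simpa using hk)
      exact hσ (ae_eq_bot.1 (Filter.eventually_false_iff_eq_bot.1 hfalse))
    · exact hlt
  have hstate := isChannelState_normalize hmem hch hpos
  have hform0 : pairingForm ε μ U φ = 0 := by
    unfold pairingForm
    simp only [klsl_integral_kernel_odd_of hε μ U hD hK _ hodd, mul_zero, integral_zero]
  have hval : pairingForm ε μ U (fun k => (Real.sqrt (∫ k, φ k ^ 2 ∂fermiCurveMeasure ε μ))⁻¹ * φ k) = 0 := by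
    have h := klb1g_form_smul (fermiCurveMeasure ε μ) (kohnLuttingerKernel ε μ U) φ
      (Real.sqrt (∫ k, φ k ^ 2 ∂fermiCurveMeasure ε μ))⁻¹
    unfold pairingForm at hform0 ⊢
    rw [h, hform0, mul_zero]
  unfold channelInf
  exact (csInf_le hbdd ⟨_, hstate, rfl⟩).trans hval.le

/-- **The channel bottoms of `squareDispersion 0 (-1)` are `≤ 0`** on `μ ∈ (-4, 0)`: every channel carries a deck-odd lattice harmonic
(`cos k₀ + cos k₁`, `sin k₀ sin k₁ (cos k₀ - cos k₁)`, `cos k₀ - cos k₁`, `sin k₀ sin k₁ (cos k₀ + cos k₁)`, `sin k₀`) that is non-zero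
almost everywhere on the Fermi curve. [cite: RaghuKivelsonScalapino2010, §III (17)] -/
theorem klsl_channelInf_neg_nonpos {μ : ℝ} (hμ : μ ∈ Ioo (-4 : ℝ) 0) (U : ℝ) (χ : D4Irrep) :
    channelInf (squareDispersion 0 (-1)) μ U χ ≤ 0 := by
  haveI := klsl_isFiniteMeasure_neg hμ
  haveI := klsl_isFiniteMeasure_nnn hμ
  haveI := stub_klFiniteMeasure stub_klGradient stub_klHausdorffFinite μ hμ
  have hε := measurable_squareDispersion 0 (-1)
  have hD := klsl_measurePreserving_shift_neg μ
  have hK := klsl_kernel_neg_shift_right μ U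
  have hbdd := klsl_bddBelow_of (klsl_kernelHS_neg hμ) U χ
  -- the measure is non-zero: its mass is that of `σ`, which carries normalised states
  have hσ : fermiCurveMeasure (squareDispersion 0 (-1)) μ ≠ 0 := by
    intro h0
    obtain ⟨ψ, hψ⟩ := nonempty_isChannelState hμ.1 hμ.2 D4Irrep.A1g
    have h1 : fermiCurveMeasure (squareDispersion 0 1) μ univ = 0 := by
      rw [← preimage_univ (f := klslFlip),
        (klsl_measurePreserving_flip_fermi' μ).measure_preimage MeasurableSet.univ.nullMeasurableSet, h0]
      simp
    have h2 : fermiCurveMeasure (squareDispersion 1 0) μ univ = 0 := by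
      rw [← klsl_map_cover_fermiCurveMeasure μ, Measure.map_apply measurable_klslCover MeasurableSet.univ, preimage_univ, h1]
    have h3 := hψ.2.1
    rw [Measure.measure_univ_eq_zero.1 h2, integral_zero_measure] at h3
    exact zero_ne_one h3
  have hG := klsl_ae_mem_klphGood_neg μ
  have hF := ae_mem_fermiCurve hε μ
  have hZ := measure_eq_zero_iff_ae_notMem.1 (klsl_fermiCurveMeasure_neg_cosSum_null μ)
  -- basic a.e. facts on the good set / the Fermi curve
  have hsin0 : ∀ k ∈ klphGood, sin (k 0) ≠ 0 := fun k hk h => by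
    have h' := hk 0
    have := (sin_eq_zero_iff_of_lt_of_lt (abs_lt.1 h'.2).1 (abs_lt.1 h'.2).2).1 h
    exact (abs_pos.1 h'.1) this
  have hsin1 : ∀ k ∈ klphGood, sin (k 1) ≠ 0 := fun k hk h => by
    have h' := hk 1
    have := (sin_eq_zero_iff_of_lt_of_lt (abs_lt.1 h'.2).1 (abs_lt.1 h'.2).2).1 h
    exact (abs_pos.1 h'.1) this
  have hodd_cos : ∀ k ∈ brillouinZone, cos (klphShift k 0) = -cos (k 0) ∧ cos (klphShift k 1) = -cos (k 1) :=
    fun k hk => ⟨by rw [klphShift_apply_zero, cos_klphTau (hk 0)], by rw [klphShift_apply_one, cos_klphTau (hk 1)]⟩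
  have hodd_sin : ∀ k ∈ brillouinZone, sin (klphShift k 0) = -sin (k 0) ∧ sin (klphShift k 1) = -sin (k 1) :=
    fun k hk => ⟨by rw [klphShift_apply_zero, sin_klphTau (hk 0)], by rw [klphShift_apply_one, sin_klphTau (hk 1)]⟩
  have hm0 : Measurable fun k : Momentum => cos (k 0) := measurable_cos.comp klsl_measurable_fst
  have hm1 : Measurable fun k : Momentum => cos (k 1) := measurable_cos.comp klsl_measurable_snd
  have hs0 : Measurable fun k : Momentum => sin (k 0) := measurable_sin.comp klsl_measurable_fst
  have hs1 : Measurable fun k : Momentum => sin (k 1) := measurable_sin.comp klsl_measurable_snd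
  cases χ with
  | A1g =>
    refine klsl_channelInf_nonpos_of_odd hε U hD hK hbdd hσ (φ := fun k : Momentum => cos (k 0) + cos (k 1))
      (hm0.add hm1) (C := 2) (fun k => ?_) (klsl_inChannel_A1g_of_invariant fun γ k => klsl_cosSum_invariant γ k) ?_ ?_
    · have h1 := abs_cos_le_one (k 0); have h2 := abs_cos_le_one (k 1)
      exact (abs_add_le _ _).trans (by linarith)
    · filter_upwards [hF] with k hk
      obtain ⟨h0, h1⟩ := hodd_cos k hk.1
      rw [h0, h1]; ring
    · filter_upwards [hZ] with k hk
      exact hk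
  | A2g =>
    refine klsl_channelInf_nonpos_of_odd hε U hD hK hbdd hσ
      (φ := fun k : Momentum => sin (k 0) * sin (k 1) * (cos (k 0) - cos (k 1)))
      ((hs0.mul hs1).mul (hm0.sub hm1)) (C := 2) (fun k => ?_) inChannel_A2g_harmonic ?_ ?_
    · have h1 := abs_sin_le_one (k 0); have h2 := abs_sin_le_one (k 1)
      have h3 := abs_cos_le_one (k 0); have h4 := abs_cos_le_one (k 1)
      have h5 : |cos (k 0) - cos (k 1)| ≤ 2 := (abs_sub _ _).trans (by linarith)
      rw [abs_mul, abs_mul]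
      have h6 : |sin (k 0)| * |sin (k 1)| ≤ 1 := mul_le_one₀ h1 (abs_nonneg _) h2
      nlinarith [abs_nonneg (sin (k 0)), abs_nonneg (sin (k 1)), abs_nonneg (cos (k 0) - cos (k 1)),
        mul_nonneg (abs_nonneg (sin (k 0))) (abs_nonneg (sin (k 1)))]
    · filter_upwards [hF] with k hk
      obtain ⟨h0, h1⟩ := hodd_cos k hk.1
      obtain ⟨h2, h3⟩ := hodd_sin k hk.1
      rw [h0, h1, h2, h3]; ring
    · filter_upwards [hG, hF] with k hk hkF
      exact mul_ne_zero (mul_ne_zero (hsin0 k hk) (hsin1 k hk)) (klsl_cos_ne_cos_of_mem_fermiCurve_neg hμ.2 hkF)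
  | B1g =>
    refine klsl_channelInf_nonpos_of_odd hε U hD hK hbdd hσ (φ := fun k : Momentum => cos (k 0) - cos (k 1))
      (hm0.sub hm1) (C := 2) (fun k => ?_) inChannel_B1g_harmonic ?_ ?_
    · have h1 := abs_cos_le_one (k 0); have h2 := abs_cos_le_one (k 1)
      exact (abs_sub _ _).trans (by linarith)
    · filter_upwards [hF] with k hk
      obtain ⟨h0, h1⟩ := hodd_cos k hk.1
      rw [h0, h1]; ring
    · filter_upwards [hF] with k hkF
      exact klsl_cos_ne_cos_of_mem_fermiCurve_neg hμ.2 hkF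
  | B2g =>
    refine klsl_channelInf_nonpos_of_odd hε U hD hK hbdd hσ
      (φ := fun k : Momentum => sin (k 0) * sin (k 1) * (cos (k 0) + cos (k 1)))
      ((hs0.mul hs1).mul (hm0.add hm1)) (C := 2) (fun k => ?_)
      (klsl_inChannel_mul_invariant inChannel_B2g_harmonic fun γ k => klsl_cosSum_invariant γ k) ?_ ?_
    · have h1 := abs_sin_le_one (k 0); have h2 := abs_sin_le_one (k 1)
      have h3 := abs_cos_le_one (k 0); have h4 := abs_cos_le_one (k 1)
      have h5 : |cos (k 0) + cos (k 1)| ≤ 2 := (abs_add_le _ _).trans (by linarith)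
      rw [abs_mul, abs_mul]
      have h6 : |sin (k 0)| * |sin (k 1)| ≤ 1 := mul_le_one₀ h1 (abs_nonneg _) h2
      nlinarith [abs_nonneg (sin (k 0)), abs_nonneg (sin (k 1)), abs_nonneg (cos (k 0) + cos (k 1)),
        mul_nonneg (abs_nonneg (sin (k 0))) (abs_nonneg (sin (k 1)))]
    · filter_upwards [hF] with k hk
      obtain ⟨h0, h1⟩ := hodd_cos k hk.1
      obtain ⟨h2, h3⟩ := hodd_sin k hk.1
      rw [h0, h1, h2, h3]; ring
    · filter_upwards [hG, hZ] with k hk hkZ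
      exact mul_ne_zero (mul_ne_zero (hsin0 k hk) (hsin1 k hk)) hkZ
  | E =>
    refine klsl_channelInf_nonpos_of_odd hε U hD hK hbdd hσ (φ := fun k : Momentum => sin (k 0)) hs0 (C := 1)
      (fun k => abs_sin_le_one (k 0)) inChannel_E_harmonic ?_ ?_
    · filter_upwards [hF] with k hk
      exact (hodd_sin k hk.1).1
    · filter_upwards [hG] with k hk
      exact hsin0 k hk

/-! ### §27 Support S3: the sign of `t'` is immaterial -/

/-- The channel bottoms of the pure `t'` band are `≤ 0` on `(-4, 0)` (duality + `CwThesis.stub_channelInfNonpos`). [folklore] -/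
theorem klsl_channelInf_nnn_nonpos {μ : ℝ} (hμ : μ ∈ Ioo (-4 : ℝ) 0) (U : ℝ) (χ : D4Irrep) :
    channelInf (squareDispersion 0 1) μ U χ ≤ 0 := by
  have h := klsl_channelInf_sublattice_eq hμ U (klslTau χ)
  rw [klslTau_klslTau] at h
  rw [h]
  exact CwThesis.stub_channelInfNonpos U _ hμ

/-- **Support S3 — one inequality**: `channelInf (squareDispersion 0 (-1)) μ U χ ≤ channelInf (squareDispersion 0 1) μ U χ` on `(-4, 0)`.
[cite: RaghuKivelsonScalapino2010, §II (13)] -/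
theorem klsl_channelInf_neg_le_nnn {μ : ℝ} (hμ : μ ∈ Ioo (-4 : ℝ) 0) (U : ℝ) (χ : D4Irrep) :
    channelInf (squareDispersion 0 (-1)) μ U χ ≤ channelInf (squareDispersion 0 1) μ U χ := by
  haveI := klsl_isFiniteMeasure_nnn hμ
  haveI := klsl_isFiniteMeasure_neg hμ
  refine klsl_channelInf_le_of_evenTransport U χ (fun f hf => ?_) (fun e hemem hech heven => ?_)
    (klsl_bddBelow_of (klsl_kernelHS_neg hμ) U χ) (klsl_channelInf_neg_nonpos hμ U χ)
  · exact klsl_exists_even_part (measurable_squareDispersion 0 1) U (klsl_kernelHS_nnn hμ) (klsl_measurePreserving_shift_nnn μ)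
      (klsl_kernel_nnn_shift_right μ U) (klsl_ae_mem_klphGood_nnn μ) hf
  · obtain ⟨h1, h2, -, h3, h4⟩ := klsl_flip_transport (εa := squareDispersion 0 1) (εb := squareDispersion 0 (-1))
      (measurable_squareDispersion 0 (-1)) U (klsl_measurePreserving_flip_fermi μ)
      (fun k hk k' hk' => by rw [klsl_kohnLuttingerKernel_negSign, klsl_kernel_nnn_flip U hk hk'])
      (klsl_ae_mem_klphGood_neg μ) hemem hech heven
    exact ⟨_, h1, h2, h3, h4⟩

/-- **Support S3 — the other inequality.** [cite: RaghuKivelsonScalapino2010, §II (13)] -/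
theorem klsl_channelInf_nnn_le_neg {μ : ℝ} (hμ : μ ∈ Ioo (-4 : ℝ) 0) (U : ℝ) (χ : D4Irrep) :
    channelInf (squareDispersion 0 1) μ U χ ≤ channelInf (squareDispersion 0 (-1)) μ U χ := by
  haveI := klsl_isFiniteMeasure_nnn hμ
  haveI := klsl_isFiniteMeasure_neg hμ
  refine klsl_channelInf_le_of_evenTransport U χ (fun f hf => ?_) (fun e hemem hech heven => ?_)
    (klsl_bddBelow_nnn hμ U χ) (klsl_channelInf_nnn_nonpos hμ U χ)
  · exact klsl_exists_even_part (measurable_squareDispersion 0 (-1)) U (klsl_kernelHS_neg hμ) (klsl_measurePreserving_shift_neg μ)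
      (klsl_kernel_neg_shift_right μ U) (klsl_ae_mem_klphGood_neg μ) hf
  · obtain ⟨h1, h2, -, h3, h4⟩ := klsl_flip_transport (εa := squareDispersion 0 (-1)) (εb := squareDispersion 0 1)
      (measurable_squareDispersion 0 1) U (klsl_measurePreserving_flip_fermi' μ)
      (fun k hk k' hk' => by rw [klsl_kohnLuttingerKernel_negSign, klsl_kernel_nnn_flip U hk hk'])
      (klsl_ae_mem_klphGood_nnn μ) hemem hech heven
    exact ⟨_, h1, h2, h3, h4⟩

/-- **Support S3 `ChannelInfNNNSign` — the sign of `t'` is immaterial on `μ ∈ (-4, 0)`**: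
`channelInf (squareDispersion 0 (-1)) μ U χ = channelInf (squareDispersion 0 1) μ U χ`. [cite: RaghuKivelsonScalapino2010, §II (13)] -/
theorem klsl_channelInf_negSign {μ : ℝ} (hμ : μ ∈ Ioo (-4 : ℝ) 0) (U : ℝ) (χ : D4Irrep) :
    channelInf (squareDispersion 0 (-1)) μ U χ = channelInf (squareDispersion 0 1) μ U χ :=
  le_antisymm (klsl_channelInf_neg_le_nnn hμ U χ) (klsl_channelInf_nnn_le_neg hμ U χ)

namespace KlSublattice

/-- **S3 holds.** [folklore] -/
theorem channelInfNNNSign_holds : ChannelInfNNNSign := fun _ hμ U χ => klsl_channelInf_negSign hμ U χ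

/-- **The dual window for the physical sign `t' < 0` modulo ONLY the enclosures**: for `squareDispersion 0 (-1)` on
`μ ∈ [-0.8925, -0.075]`, `U ∈ (0,1)`, `B2g` leads every other channel by `γU²` (S3, K1, K2 discharged). [cite: RaghuKivelsonScalapino2010, §II (13)] -/
theorem dualWindowB2g_negSign_of_enclosures
    (hU1 : klCertB1gWinU1.EnclosuresB1g) (hU2 : klCertB1gWinU2.EnclosuresB1g) (hU3 : klCertB1gWinU3.EnclosuresB1g)
    (hV : klCertB1gWinV.EnclosuresB1g) (hW : klCertB1gWinW.EnclosuresB1g) (hX : klCertB1gWinX.EnclosuresB1g)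
    (hY : klCertB1gWinY.EnclosuresB1g) (hZ : klCertB1gWinZ.EnclosuresB1g) (hA : klCertB1gWinA.EnclosuresB1g)
    (hB : klCertB1gWinB.EnclosuresB1g) (hC : klCertB1gWinC.EnclosuresB1g) (hD : klCertB1gWinD.EnclosuresB1g) :
    ∀ μ ∈ Set.Icc (-0.8925 : ℝ) (-0.075), ∀ U ∈ Set.Ioo (0 : ℝ) 1, ∀ χ : D4Irrep, χ ≠ D4Irrep.B2g →
      channelInf (squareDispersion 0 (-1)) μ U D4Irrep.B2g + 10371 / 1048576 * U ^ 2 ≤ channelInf (squareDispersion 0 (-1)) μ U χ :=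
  dualWindowB2g_negSign_of channelInfNNNSign_holds (dualWindowB2g_d005_d035_of_enclosures hU1 hU2 hU3 hV hW hX hY hZ hA hB hC hD)

end KlSublattice

end Summit.HubbardSuperconductivity.HubbardSuperconductivity.Theorems

end
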